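import Literature.RingTheory.TightClosure.RegularTightlyClosed
import Mathlib.RingTheory.Localization.AtPrime.Basic
import Mathlib.RingTheory.Localization.Ideal
import Mathlib.RingTheory.Ideal.IsPrimary
import Mathlib.Algebra.CharP.Algebra
import HarnessLib

/-!
# Frobenius powers of primes of a regular ring are contracted from the localization

Support file for crux stmt-ResolutionOfSingularities-15317 (`FrobeniusLadder.FRationalResolution`,
line `Sketch`, continuation seat c2: the SUSPENSION CALIBRATION), stub
`stub_notMem_frobeniusPower_atPrime` (worker W2): transfer of NON-membership in a Frobenius power
from a maximal ideal `M` of a domain `S` of characteristic `p` down to the local ring at a prime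
`P ⊆ M`, when `S_M` is a regular local ring. Write `q = p^e` and `I^[q] = frobeniusPower q I`.

* `isPrimary_frobeniusPower_of_isMaximal` — `M^[q]` is `M`-primary for `M` maximal, `q ≠ 0`
  (its radical is `M`).
* `mem_frobeniusPower_of_algebraMap_mem_map` — hence `M^[q]` is contracted from `S_M`:
  `s/1 ∈ M^[q] S_M ⇒ s ∈ M^[q]`.
* `stub_notMem_frobeniusPower_atPrime` — **if `s ∉ M^[q]` then `s/1 ∉ (P S_P)^[q]`.** Proof:
  Frobenius powers commute with extension of ideals (`(I T)^[q] = I^[q] T`, both being the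
  extension of `I` along `φ ∘ F^e = F^e ∘ φ`; this is
  `FInjectiveMacaulayfication.Fedder.frobeniusPower_map`, inlined here to keep the import light), so
  otherwise `u s ∈ P^[q]` for some `u ∉ P`; in the regular local ring `T = S_M` the extension
  `P' = P T` is a prime not containing `u`, and `s · u^q ∈ P'^[q]`, so Kunz's flat colon
  (`mem_frobeniusPower_colon_of_isRegularLocalRing`, Huneke–Swanson, proof of Thm. 13.1.2 (6))
  gives `s ∈ (P' : u)^[q] = P'^[q] ⊆ (M T)^[q] = M^[q] T`, whence `s ∈ M^[q]` by the contraction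
  lemma — a contradiction.
-/

-- single-problem summit: the doubled namespace component is forced
set_option linter.dupNamespace false

namespace Summit.ResolutionOfSingularities.ResolutionOfSingularities.Theorems.FRationalResolution

open IsLocalRing Literature.RingTheory.TightClosure

/-- For a maximal ideal `M` and `q ≠ 0`, the Frobenius power `M^[q]` is `M`-primary: its
radical is `M` (`M^[q] ⊆ M`, and `x ∈ M ⇒ x^q ∈ M^[q]`). -/
theorem isPrimary_frobeniusPower_of_isMaximal {S : Type*} [CommRing S] (M : Ideal S)
    [hM : M.IsMaximal] {q : ℕ} (hq : q ≠ 0) : (frobeniusPower q M).IsPrimary := by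
  apply Ideal.isPrimary_of_isMaximal_radical
  have hrad : (frobeniusPower q M).radical = M := by
    refine le_antisymm (hM.isPrime.radical_le_iff.mpr (frobeniusPower_le hq M)) ?_
    intro x hx
    exact ⟨q, pow_mem_frobeniusPower hx⟩
  rw [hrad]
  exact hM

/-- `M^[q]` is contracted from the localization at the maximal ideal `M` (`q ≠ 0`): if
`s/1 ∈ M^[q] S_M` then `s ∈ M^[q]` (a primary ideal disjoint from the multiplicative set is
contracted, `IsLocalization.under_map_of_isPrimary_disjoint`). -/
theorem mem_frobeniusPower_of_algebraMap_mem_map {S : Type*} [CommRing S] (M : Ideal S)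
    [M.IsMaximal] {q : ℕ} (hq : q ≠ 0) (T : Type*) [CommRing T] [Algebra S T]
    [IsLocalization.AtPrime T M] {s : S}
    (h : algebraMap S T s ∈ (frobeniusPower q M).map (algebraMap S T)) :
    s ∈ frobeniusPower q M := by
  have hdisj : Disjoint (M.primeCompl : Set S) (frobeniusPower q M : Set S) :=
    Set.disjoint_left.mpr fun x hxM hx => hxM (frobeniusPower_le hq M hx)
  rw [← IsLocalization.under_map_of_isPrimary_disjoint M.primeCompl T
    (isPrimary_frobeniusPower_of_isMaximal M hq) hdisj]
  exact Ideal.mem_comap.mpr h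

/-- **Frobenius powers of primes are contracted** (transfer of non-membership from a maximal ideal
to the local ring at a smaller prime). `S` a domain of characteristic `p`, `P ⊆ M`, `P` prime, `M`
maximal with `S_M` regular local, `q = p^e`. If `s ∉ M^[q]` then `s/1 ∉ (P S_P)^[q]`. Proof: else
`u s ∈ P^[q]` for some `u ∉ P` (`(P S_P)^[q] = P^[q] S_P`); in the regular local ring `S_M`, Kunz's
flat colon (`mem_frobeniusPower_colon_of_isRegularLocalRing` with `I = P S_M`, `x = u`, `c = s`)
gives `s ∈ ((P S_M) : u)^[q] = (P S_M)^[q] ⊆ (M S_M)^[q] = M^[q] S_M`, and `M^[q] S_M ∩ S = M^[q]`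
(`M^[q]` is `M`-primary). -/
theorem stub_notMem_frobeniusPower_atPrime (p : ℕ) [Fact p.Prime] (S : Type) [CommRing S]
    [IsDomain S] [CharP S p] (P M : Ideal S) [P.IsPrime] [M.IsMaximal] (hPM : P ≤ M)
    [IsRegularLocalRing (Localization.AtPrime M)] (e : ℕ) (s : S)
    (hs : s ∉ frobeniusPower (p ^ e) M) :
    algebraMap S (Localization.AtPrime P) s ∉
      frobeniusPower (p ^ e) (IsLocalRing.maximalIdeal (Localization.AtPrime P)) := by
  have hp : p.Prime := Fact.out
  have hq : p ^ e ≠ 0 := pow_ne_zero e hp.ne_zero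
  -- Frobenius powers commute with extension to the local rings `S_Q` (`S` a domain, so `S_Q` has
  -- characteristic `p`): `(I S_Q)^[q] = I^[q] S_Q`.
  have hmap : ∀ (Q : Ideal S) [Q.IsPrime] (I : Ideal S),
      frobeniusPower (p ^ e) (I.map (algebraMap S (Localization.AtPrime Q))) =
        (frobeniusPower (p ^ e) I).map (algebraMap S (Localization.AtPrime Q)) := by
    intro Q _ I
    haveI : CharP (Localization.AtPrime Q) p := charP_of_injective_algebraMap' S p
    rw [frobeniusPower_eq_map_iterateFrobenius, frobeniusPower_eq_map_iterateFrobenius,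
      Ideal.map_map, Ideal.map_map]
    congr 1
    ext a
    simp only [RingHom.coe_comp, Function.comp_apply, iterateFrobenius_def, map_pow]
  intro hmem
  apply hs
  -- Step 1: pull back to `S`: `u * s ∈ P^[q]` for some `u ∉ P`.
  rw [← IsLocalization.AtPrime.map_eq_maximalIdeal P (Localization.AtPrime P), hmap P,
    IsLocalization.algebraMap_mem_map_algebraMap_iff P.primeCompl] at hmem
  obtain ⟨u, huP, hus⟩ := hmem
  rw [Ideal.mem_primeCompl_iff] at huP
  -- Step 2: in the regular local ring `T = S_M`, `P' = P T` is a prime not containing `u`.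
  haveI : CharP (Localization.AtPrime M) p := charP_of_injective_algebraMap' S p
  have hdisj : Disjoint (M.primeCompl : Set S) (P : Set S) :=
    Set.disjoint_left.mpr fun x hxM hxP => hxM (hPM hxP)
  have hP'p : (P.map (algebraMap S (Localization.AtPrime M))).IsPrime :=
    IsLocalization.isPrime_of_isPrime_disjoint M.primeCompl _ P ‹_› hdisj
  have huP' : algebraMap S (Localization.AtPrime M) u ∉
      P.map (algebraMap S (Localization.AtPrime M)) := by
    intro h
    apply huP
    have h' : u ∈ (P.map (algebraMap S (Localization.AtPrime M))).under S := Ideal.mem_comap.mpr h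
    rwa [IsLocalization.under_map_of_isPrime_disjoint M.primeCompl (Localization.AtPrime M) ‹_›
      hdisj] at h'
  -- `s · u^q ∈ P'^[q]`
  have h1 : algebraMap S (Localization.AtPrime M) s *
      algebraMap S (Localization.AtPrime M) u ^ p ^ e ∈
        frobeniusPower (p ^ e) (P.map (algebraMap S (Localization.AtPrime M))) := by
    have h2 : algebraMap S (Localization.AtPrime M) (u * s) ∈
        frobeniusPower (p ^ e) (P.map (algebraMap S (Localization.AtPrime M))) := by
      rw [hmap M]
      exact Ideal.mem_map_of_mem _ hus
    have h3 : algebraMap S (Localization.AtPrime M) s *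
        algebraMap S (Localization.AtPrime M) u ^ p ^ e =
          algebraMap S (Localization.AtPrime M) u ^ (p ^ e - 1) *
            algebraMap S (Localization.AtPrime M) (u * s) := by
      rw [map_mul, ← mul_assoc, ← pow_succ, Nat.sub_add_cancel (Nat.one_le_pow _ _ hp.pos),
        mul_comm]
    rw [h3]
    exact Ideal.mul_mem_left _ _ h2
  -- Kunz's flat colon: `s ∈ (P' : u)^[q]`, and `(P' : u) = P'` since `u ∉ P'`.
  have h4 := mem_frobeniusPower_colon_of_isRegularLocalRing p e h1
  have hcolon : (P.map (algebraMap S (Localization.AtPrime M))).colon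
      {algebraMap S (Localization.AtPrime M) u} ≤
        P.map (algebraMap S (Localization.AtPrime M)) := fun r hr =>
    (hP'p.mem_or_mem (Submodule.mem_colon_singleton.mp hr)).resolve_right huP'
  -- `P'^[q] ⊆ (M T)^[q] = M^[q] T`
  have h5 : algebraMap S (Localization.AtPrime M) s ∈
      (frobeniusPower (p ^ e) M).map (algebraMap S (Localization.AtPrime M)) := by
    rw [← hmap M]
    exact frobeniusPower_mono _ (hcolon.trans (Ideal.map_mono hPM)) h4
  -- Step 3: contract at the maximal ideal `M`.
  exact mem_frobeniusPower_of_algebraMap_mem_map M hq (Localization.AtPrime M) h5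

end Summit.ResolutionOfSingularities.ResolutionOfSingularities.Theorems.FRationalResolution
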